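import Literature.AlgebraicGeometry.HodgeTheory.CyclicCoverPencilModelIsotopyRadius
import HarnessLib

/-!
# The model isotopy of the nodal pencil: flow law

Family `hodge`, layer `Literature/AlgebraicGeometry/HodgeTheory`; step A3b (fourth part): `J(θ + θ', x) = J(θ, J(θ', x))` at the points of
`CyclicCoverPencilModelIsotopyProps.chartModelIsotopy_nodal_spec` (the intermediate point `J(θ', x)` again satisfies the hypotheses: same remaining
coefficients, rotated affine coordinates in the chart ball, pencil coordinate of the same modulus), from the flow law of the weighted rotation
(`PhamBrieskornWeightedRotation.modelIsotopy_add`).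

* `chartModelIsotopy_add`.

Everything is proved; no definitions, no named facts.

## References

* [Milnor1968] J. Milnor, Singular Points of Complex Hypersurfaces (1968), §9 Lemma 9.4.
-/

noncomputable section

open MvPolynomial Set Function Complex
open Literature.AlgebraicGeometry.Motives Literature.AlgebraicGeometry.Motives.UniversalHypersurface
open Literature.AlgebraicGeometry.HodgeTheory.UniversalHypersurface Literature.Geometry.ComplexAnalytic

namespace Literature.AlgebraicGeometry.HodgeTheory

/-- **Flow law of the model isotopy** at the good points. [cite: Milnor1968, §9 Lemma 9.4] -/
theorem chartModelIsotopy_add {p : ℕ} (hp : 3 ≤ p)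
    (Φ : OpenPartialHomeomorph (ComplexPoints (regularTotal ℂ 2 p)) (({m : DegIndex 2 p // m ≠ regPowIndex 2 p 2} ⊕ Fin (2 + 1)) → ℂ))
    (hΦ : ⇑Φ = regChartFun 2 p 2) (hΦs : Φ.source = regChartDom 2 p 2) (hΦt : Φ.target = regChartFun 2 p 2 '' regChartDom 2 p 2)
    (Θ : OpenPartialHomeomorph (Fin (1 + 2) → ℂ) (Fin (1 + 2) → ℂ)) {r : ℝ}
    (hr : {z : Fin (1 + 2) → ℂ | ∑ i, ‖z i‖ ^ 2 ≤ r ^ 2} ⊆ Θ.target)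
    (hΘφ : ∀ x ∈ Θ.source, ∑ i, (Θ x) i ^ PhamBrieskorn.cyclicNodeExponents p i = x 2 ^ p - (x 0 * x 1 + x 0 ^ p + x 1 ^ p))
    {ρW : ℝ}
    (hns : ∀ c : ℂ, c ≠ 0 → ‖c‖ < ρW → SmoothHypersurface.IsNonsingularForm ℂ (formOfCoeffs
      (coeffsOf 2 p (cyclicCoverForm p (X 2 ^ (p - 2) * (X 0 * X 1) + X 0 ^ p + X 1 ^ p)) - Pi.single (regPowIndex 2 p 2) c)))
    {x : ComplexPoints (regularTotal ℂ 2 p)} (hx : x ∈ Φ.source)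
    (hb : ∀ m : {m : DegIndex 2 p // m ≠ regPowIndex 2 p 2},
      regCoeff ℂ 2 p x m.1 = coeffsOf 2 p (cyclicCoverForm p (X 2 ^ (p - 2) * (X 0 * X 1) + X 0 ^ p + X 1 ^ p)) m.1)
    (hy : (fun j => regChartFun 2 p 2 x (Sum.inr j)) ∈ Θ.source)
    (hyr : ∑ i, ‖Θ (fun j => regChartFun 2 p 2 x (Sum.inr j)) i‖ ^ 2 < r ^ 2)
    (hc0 : pencilCoord p x ≠ 0) (hcρ : ‖pencilCoord p x‖ < ρW) (θ θ' : ℝ) :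
    chartModelIsotopy (PhamBrieskorn.cyclicNodeExponents p) Φ Θ (θ + θ') x =
      chartModelIsotopy (PhamBrieskorn.cyclicNodeExponents p) Φ Θ θ
        (chartModelIsotopy (PhamBrieskorn.cyclicNodeExponents p) Φ Θ θ' x) := by
  -- the intermediate point and its data
  set x' := chartModelIsotopy (PhamBrieskorn.cyclicNodeExponents p) Φ Θ θ' x with hx'def
  obtain ⟨hx's, hΦx'⟩ := chartModelIsotopy_nodal_spec hp Φ hΦ hΦs hΦt Θ hr hΘφ hns hx hb hy hyr hc0 hcρ θ'
  have hA := affine_chartModelIsotopy hp Φ hΦ hΦs hΦt Θ hr hΘφ hns hx hb hy hyr hc0 hcρ θ'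
  have hB : (fun m : {m : DegIndex 2 p // m ≠ regPowIndex 2 p 2} => Φ x' (Sum.inl m)) = fun m => Φ x (Sum.inl m) := by
    funext m; exact congrFun hΦx' (Sum.inl m)
  -- unfold both sides
  rw [chartModelIsotopy_of_mem _ Φ Θ hx, chartModelIsotopy_of_mem _ Φ Θ hx's, hB]
  congr 1
  funext s
  rcases s with m | j
  · rfl
  · simp only [Sum.elim_inr]
    have hA' : (fun j => Φ x' (Sum.inr j)) =
        Θ.symm (fun k => Complex.exp (((θ' / PhamBrieskorn.cyclicNodeExponents p k : ℝ) : ℂ) * I) *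
          Θ (fun j => regChartFun 2 p 2 x (Sum.inr j)) k) := by
      rw [hΦ]; exact hA
    rw [hA', hΦ]
    exact congrFun (PhamBrieskorn.modelIsotopy_add (PhamBrieskorn.cyclicNodeExponents p) Θ hr hyr θ θ') j

end Literature.AlgebraicGeometry.HodgeTheory

end
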